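import Mathlib.LinearAlgebra.Finsupp.LinearCombination
import Mathlib.Algebra.BigOperators.Finsupp.Basic
import Literature.RepresentationTheory.Liu2021.AlbaneseBlockMultiplicityOne

/-!
# Liu 2021, Thm. 4.18 (1): `K`-fixed vectors of the CM pull-back image come from `K`-fixed
# `M_μ`-rational elements of `Ω(μ) ⊗_{M_μ} ℂ` — Step 2 of the «combined reading» in the kernel,
# and Steps 3–5 as source-side hypotheses

Yifeng Liu, *Fourier–Jacobi cycles and arithmetic relative trace formula*, Cambridge J. Math. **9**
(2021), no. 1, 1–147 = arXiv:2102.11518 [Liu2021]; TeX source `FJcycle.tex` of the arXiv e-print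
(md5 `6db49a74122d2cb0f224fa1b39488a0c`), line numbers `l. NNNN` below.

## Why this file (the gap it narrows)

This is the sequel of `AlbaneseBlockMultiplicityOne.lean`, which proved STEP 1 of the derivation
(«combined reading», citation manifest row CF07, conjunct (5) `Thm418C` / `Thm418Combined` of the
Hodge-CM stage-1 package) of the consumed sentence

  for `τ' ∈ Φ_μ` and `K` small, every `K`-fixed vector of the intrinsic `μ`-block of
  `H = H¹_{B,τ'}(A_∞, ℂ)` restricts, on the identity component `P_K`, into the `ℂ`-span of the CM
  pull-back classes,

namely «`block μ` = image of the pull-back map (4.2) `j : Ω(μ) ⊗_{M_μ} ℂ ≅ ⊕_{ε,χ} ω(μ,ε,χ) → H`»,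
and kept the remaining Steps 2–5 as ONE hypothesis `hmap` about the IMAGE of `j`:
«below some level `K₀`, every `K`-fixed vector `j y` restricts into `span (cmCl K μ)`».
The prose derivation of record (the literature seats' «R8 §E») obtains `hmap` as follows.

  STEP 2 [standard]. A `K`-fixed vector of the image of (4.2) is the image of a `K`-fixed element
  of `Ω(μ) ⊗_{M_μ} ℂ`, and `(Ω(μ) ⊗_{M_μ} ℂ)^K = Ω(μ)^K ⊗_{M_μ} ℂ` (R8 §E argues with the averaging
  idempotent `e_K` of `K` acting through a finite quotient, using that (4.2) is `G`-equivariant and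
  that `G(𝔸_F^∞)` acts `M_μ`-linearly on `Ω(μ)` — [Liu2021] Def. 4.16, l. 2219, AS PRINTED: "the
  `ℚ`-vector space `Hom_E(A_∞,A_μ)_ℚ` is an `M_μ[G(𝔸_F^∞)]`-module, where `M_μ` acts via `i_μ` and
  `G(𝔸_F^∞)` acts `M_μ`-linearly via its action on `A_∞`").
  STEP 3 [Liu2021, Thm. 4.18 (1), l. 2239, AS PRINTED: "For every object
  `D_μ=(A_μ,i_μ,λ_μ,r_μ) ∈ 𝒜(μ)`, we have a canonical isomorphism `Ω(μ)^K ≃ Hom_E(A_K,A_μ)_ℚ` for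
  every sufficiently small open compact subgroup `K ⊆ G(𝔸_F^∞)`"; with Rem. 4.17, l. 2226–2228
  ("the canonical map `Hom_E(A_∞,A_μ)_ℚ → Ω(μ)` is an isomorphism")]. Hence, for `K ≤ K₀(μ, D_μ)`,
  a `K`-fixed element of `Ω(μ) ⊗_{M_μ} ℂ` is a `ℂ`-combination `Σ z_i (f_i ⊗ 1)` of (classes of)
  honest homomorphisms `f_i ∈ Hom_E(A_K, A_μ)`.
  STEP 4 [Liu2021, Lem. 2.4 (1), l. 1213, AS PRINTED: "for every homomorphism `τ : k → ℂ`, we have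
  a canonical isomorphism `H¹_{B,τ}(Alb_X, ℚ) ≃ H¹_{B,τ}(X, ℚ)`", via `(α_X)_x^*` for any base point,
  independent of `x` (proof, ll. 1220–1228); applied at ll. 2122–2124].
  STEP 5 [standard, functoriality of Betti `H¹`]. `(f_i^* α)|_{P_K}` is the pull-back of `α` along
  the morphism `P_K → X_{K,ℂ} → A_{K,ℂ} → A_{μ,ℂ}`, i.e. one of the CM classes `cmCl K μ` —
  PROVIDED Liu's datum `(D_μ, α)` is among the instance's admissible CM data (the model's `adm`
  contract: an object-match obligation, not a citation question).

THIS FILE puts STEP 2 — both halves — in the kernel and isolates STEPS 3–5 as hypotheses about the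
SOURCE `⊕_a ω(μ,a) ≅ Ω(μ) ⊗_{M_μ} ℂ` of `j` (not about its image), each the transcript of the
printed sentences above:

* STEP 2, first half (`smul_eq_self_of_injective`, `exists_fixed_preimage_of_mem_range`) needs NO
  averaging, NO smoothness and NO characteristic-zero hypothesis: (4.2) is INJECTIVE (proof of
  Thm. 4.18, ll. 2247–2270: it induces the isomorphism of the statement) and EQUIVARIANT (l. 2250:
  "which is `ℂ[G(𝔸_F^∞)]`-linear"), so if `j y` is fixed by an operator `s` then
  `j (s • y) = s • j y = j y` forces `s • y = y`.
* STEP 2, second half (`mem_span_fixed_rational_of_fixed`, section `BaseChange`): base change of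
  invariants, in coordinates — for a `k`-basis `b` of `V` and a subfield `M ⊆ k`, if operators
  commuting with the `k`-scalars have `M`-RATIONAL matrices in `b` (Def. 4.16: `G` acts
  `M_μ`-linearly on `Ω(μ)`; `b` = an `M_μ`-basis of `Ω(μ)` transported through the `ℂ[G]`-linear
  isomorphism of Thm. 4.18, ll. 2233–2237), then every fixed vector is a `k`-combination of fixed
  `M`-rational vectors (= `(Ω(μ) ⊗_{M_μ} ℂ)^K = Ω(μ)^K ⊗_{M_μ} ℂ`).  Proved for an arbitrary field
  extension `k/M` and an arbitrary set of operators (no finiteness of `K`, no averaging).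
* `h418_1` (STEP 3 = Thm. 4.18 (1) + Rem. 4.17, typed on the rational form): below some level `K₀`,
  every `K`-fixed `M_μ`-RATIONAL `y₀` lies in the span of a set `Gen K` of «geometric generators»
  (at the model: the images of `f ⊗ 1`, `f ∈ Hom_E(A_K, A_μ)` an honest homomorphism); or, with the
  second half of Step 2 folded in, `hgen`: every `K`-fixed `y` lies in `span k (Gen K)`.
* `hcm` (STEPS 4–5 with the `adm` contract): for every geometric generator `g ∈ Gen K`,
  `res K (j g)` is in the span of the CM classes `cmCl K μ`.

From these the kernel recovers `hmap` (`mapReading_of_source_invariants`: Step 2 + linearity;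
`span_gen_of_fixed_of_rationalForm`: `h418_1` ⇒ `hgen`), and with the multiplicity-one Step 1 of the
previous file the consumed shape (`combinedReading_of_source_invariants`,
`combinedReading_of_rationalForm`; also the decomposition-route twin for the five-record binder,
`combinedReading_of_decomposition_of_source_invariants`).  Fixed vectors in `H` are phrased
through an arbitrary family `Fix K ≤ {x | ∀ s ∈ S K, s • x = x}` of subspaces cut out by sets of
operators `S K ⊆ R` (at the model `R = ℂ[G]`, `S K = {[g] : g ∈ K}`, `Fix K = fixedBy K H`; the
bridge hypothesis `hFix` is then `fun K x hx s ⟨g, hg, rfl⟩ => hx g hg`), so that the conclusion is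
literally the package's `Thm418Combined res cmCl` with `block`/`oscImage`/`Ωt` unfolded, as in the
previous file (instantiation = one `exact`).

RESIDUE after this file: exactly two readings — `h418_1` = Thm. 4.18 (1) with Rem. 4.17 (the
identification of `K`-invariants of `Ω(μ)` with `Hom_E(A_K,A_μ)_ℚ`, carriers: abelian varieties,
not hub-tree types) and `hcm` = Lem. 2.4 (1) + functoriality of Betti `H¹` + the model's `adm`
contract — plus the object match of the previous file's hypotheses.  Nothing about abelian
varieties, Albanese maps or Shimura varieties is proved here; no object match is discharged.
Theorems only: no `def`, no named fact.

## References
* [Liu2021] Y. Liu, Fourier–Jacobi cycles and arithmetic relative trace formula, Camb. J. Math. 9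
  (2021) = arXiv:2102.11518: Def. 4.16 (ll. 2218–2224), Rem. 4.17 (ll. 2226–2228), Thm. 4.18
  with (1) (ll. 2232–2245) and proof (ll. 2247–2270, eq. (4.2) = `eq:cm_albanese` l. 2251),
  Lem. 2.4 (1) (ll. 1210–1228), Prop. 4.13 proof l. 2145 (multiplicity one, used through the
  previous file).
* Hodge-CM stage-1 package, `HodgeCM/Literature/AlbaneseUnitaryShimuraModules.lean`,
  `HodgeCM.Literature.Theta.LiuAlbaneseModuleDatum.Thm418Combined`; hub tree
  `Literature.RepresentationTheory.Liu2021.combinedReading_of_rank_hom_le_one`.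
-/

namespace Literature.RepresentationTheory.Liu2021

open DirectSum

/-! ### Step 2, first half: fixed vectors of the image of an injective equivariant map -/

section StepTwo

variable {R : Type*} [Ring R] {H : Type*} [AddCommGroup H] [Module R H]
  {D : Type*} [AddCommGroup D] [Module R D]

/-- **STEP 2, one operator.**  If `j : D → H` is an injective `R`-linear map and `j y` is fixed
by the operator `s ∈ R`, then `y` is fixed by `s` (at the model: `R = ℂ[G]`, `s = [g]` for
`g ∈ K`, `j` = the pull-back map (4.2) of the proof of [Liu2021] Thm. 4.18, injective and
`ℂ[G(𝔸_F^∞)]`-linear by that proof, l. 2250).  No averaging over `K` is needed.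
[cite: Liu2021, Thm. 4.18, proof ll. 2247–2270 (eq. (4.2), l. 2250 "which is `ℂ[G(𝔸_F^∞)]`-linear")] -/
theorem smul_eq_self_of_injective (j : D →ₗ[R] H) (hj : Function.Injective j) {s : R} {y : D}
    (h : s • j y = j y) : s • y = y :=
  hj (by rw [map_smul, h])

/-- **STEP 2, a set of operators** (at the model: `S = {[g] : g ∈ K}`): if `j y` is `S`-fixed for
an injective equivariant `j`, then `y` is `S`-fixed.
[cite: Liu2021, Thm. 4.18, proof ll. 2247–2270, eq. (4.2)] -/
theorem forall_smul_eq_self_of_injective (j : D →ₗ[R] H) (hj : Function.Injective j) (S : Set R)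
    {y : D} (h : ∀ s ∈ S, s • j y = j y) : ∀ s ∈ S, s • y = y := fun s hs =>
  smul_eq_self_of_injective j hj (h s hs)

/-- **STEP 2 as worded in the derivation of record**: a `K`-fixed vector in the image of the
(injective, equivariant) pull-back map (4.2) is the image of a `K`-fixed element of its source.
[cite: Liu2021, Thm. 4.18, proof ll. 2247–2270, eq. (4.2)] -/
theorem exists_fixed_preimage_of_mem_range (j : D →ₗ[R] H) (hj : Function.Injective j)
    (S : Set R) {x : H} (hx : x ∈ LinearMap.range j) (hfix : ∀ s ∈ S, s • x = x) :
    ∃ y : D, (∀ s ∈ S, s • y = y) ∧ j y = x := by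
  obtain ⟨y, rfl⟩ := hx
  exact ⟨y, forall_smul_eq_self_of_injective j hj S hfix, rfl⟩

end StepTwo

/-! ### Step 2, second half: fixed vectors descend to a rational form (base change of invariants) -/

section BaseChange

variable {M : Type*} [Field M] {k : Type*} [Field k] [Algebra M k]
  {V : Type*} [AddCommGroup V] [Module k V] {ι : Type*} (b : Module.Basis ι k V)
  {B : Type*} (c : Module.Basis B M k)

/-- Reconstruction of `x : k` from its `M`-coordinates `c.coord β x` in an `M`-basis `c` of `k`,
summed over any finite set containing the support. [folklore] -/
private theorem sum_mul_algebraMap_coord_eq (x : k) {T : Finset B} (hT : (c.repr x).support ⊆ T) :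
    ∑ β ∈ T, c β * algebraMap M k (c.coord β x) = x := by
  have h := c.linearCombination_repr x
  rw [Finsupp.linearCombination_apply,
    Finsupp.sum_of_support_subset (c.repr x) hT (fun β a => a • c β) (fun β _ => zero_smul _ _)]
    at h
  conv_rhs => rw [← h]
  refine Finset.sum_congr rfl fun β _ => ?_
  rw [Module.Basis.coord_apply, Algebra.smul_def, mul_comm]

/-- `M`-linearity of the re-embedded coordinate `x ↦ algebraMap (c.coord β x)` against
`M`-rational factors. [folklore] -/
private theorem algebraMap_coord_mul_algebraMap (β : B) (x : k) (a : M) :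
    algebraMap M k (c.coord β (x * algebraMap M k a)) =
      algebraMap M k (c.coord β x) * algebraMap M k a := by
  rw [← map_mul, Module.Basis.coord_apply, Module.Basis.coord_apply,
    show x * algebraMap M k a = a • x by rw [Algebra.smul_def, mul_comm], map_smul,
    Finsupp.smul_apply, smul_eq_mul, mul_comm]

/-- Coordinates of the `β`-projection `P_β v := Σ_i algebraMap (c.coord β (b.repr v i)) • b i`
(written inline throughout this section). [folklore] -/
private theorem repr_proj (β : B) (v : V) (i : ι) :
    b.repr (Finsupp.linearCombination k (⇑b)
      ((b.repr v).mapRange (fun x => algebraMap M k (c.coord β x)) (by simp))) i =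
      algebraMap M k (c.coord β (b.repr v i)) := by
  rw [Module.Basis.repr_linearCombination, Finsupp.mapRange_apply]

/-- Reconstruction `v = Σ_β c β • P_β v` over any finite set of indices `β` containing the
`c`-supports of all `b`-coordinates of `v`. [folklore] -/
private theorem sum_smul_proj_eq (v : V) {T : Finset B}
    (hT : ∀ i, (c.repr (b.repr v i)).support ⊆ T) :
    ∑ β ∈ T, c β • Finsupp.linearCombination k (⇑b)
      ((b.repr v).mapRange (fun x => algebraMap M k (c.coord β x)) (by simp)) = v := by
  apply b.repr.injective
  ext i
  rw [map_sum, Finsupp.finsetSum_apply]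
  simp_rw [map_smul, Finsupp.smul_apply, repr_proj, smul_eq_mul]
  exact sum_mul_algebraMap_coord_eq c (b.repr v i) (hT i)

/-- Matrix formula: coordinates of `s • w` from the coordinates of `w` and the matrix of an
operator `s` commuting with the `k`-scalars. [folklore] -/
private theorem repr_smul_eq_sum {R : Type*} [Monoid R] [DistribMulAction R V]
    [SMulCommClass R k V] (s : R) (w : V) (j : ι) :
    b.repr (s • w) j = ∑ i ∈ (b.repr w).support, b.repr w i * b.repr (s • b i) j := by
  conv_lhs => rw [← b.linearCombination_repr w, Finsupp.linearCombination_apply, Finsupp.sum,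
    Finset.smul_sum]
  simp_rw [smul_comm s, map_sum, map_smul, Finsupp.finsetSum_apply, Finsupp.smul_apply,
    smul_eq_mul]

/-- The `β`-projection commutes with every operator whose matrix in `b` has entries in `M`.
[folklore] -/
private theorem smul_proj_eq_proj_smul {R : Type*} [Monoid R] [DistribMulAction R V]
    [SMulCommClass R k V] (s : R) (hs : ∀ i j, b.repr (s • b i) j ∈ Set.range (algebraMap M k))
    (β : B) (v : V) :
    s • Finsupp.linearCombination k (⇑b)
        ((b.repr v).mapRange (fun x => algebraMap M k (c.coord β x)) (by simp)) =
      Finsupp.linearCombination k (⇑b)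
        ((b.repr (s • v)).mapRange (fun x => algebraMap M k (c.coord β x)) (by simp)) := by
  apply b.repr.injective
  ext j
  rw [repr_smul_eq_sum, repr_proj, repr_smul_eq_sum, map_sum, map_sum]
  -- extend the left sum from the support of the projection to the support of `b.repr v`
  rw [Finset.sum_subset (s₁ := (b.repr (Finsupp.linearCombination k (⇑b)
      ((b.repr v).mapRange (fun x => algebraMap M k (c.coord β x)) (by simp)))).support)
      (s₂ := (b.repr v).support) ?_ ?_]
  · refine Finset.sum_congr rfl fun i _ => ?_
    obtain ⟨a, ha⟩ := hs i j
    rw [repr_proj, ← ha, algebraMap_coord_mul_algebraMap]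
  · intro i hi
    rw [Finsupp.mem_support_iff] at hi ⊢
    contrapose! hi
    rw [repr_proj, hi, map_zero, map_zero]
  · intro i _ hi
    rw [Finsupp.notMem_support_iff] at hi
    rw [hi, zero_mul]

/-- **STEP 2, second half — fixed vectors descend to a rational form (base change of
invariants), in coordinates.**  Let `b` be a `k`-basis of `V` and `M ⊆ k` a subfield (an
`M`-algebra structure on the field `k`); call `v` *`M`-rational* if all its `b`-coordinates lie in
`M`.  If a set `S` of operators on `V` commuting with the `k`-scalars has `M`-rational matrices in
`b` (each `s • b i` is `M`-rational), then every `S`-fixed vector is a `k`-linear combination of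
`S`-fixed `M`-rational vectors.  Arbitrary field extension `k/M`, arbitrary `S` (no finiteness, no
averaging).  At the model: `V = Ω(μ) ⊗_{M_μ} ℂ ≅ ⊕_{ε,χ} ω(μ,ε,χ)` ([Liu2021] Thm. 4.18,
ll. 2233–2237, an isomorphism "of `ℂ[G(𝔸_F^∞)]`-modules"), `b` = an `M_μ`-basis of `Ω(μ)`
transported, the operators `[g]`, `g ∈ G(𝔸_F^∞)`, act `M_μ`-linearly on `Ω(μ)` (Def. 4.16,
l. 2219: "`G(𝔸_F^∞)` acts `M_μ`-linearly via its action on `A_∞`"), whence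
`(Ω(μ) ⊗_{M_μ} ℂ)^K = Ω(μ)^K ⊗_{M_μ} ℂ`.
[cite: Liu2021, Def. 4.16 (l. 2219); Thm. 4.18 main statement (ll. 2233–2237)] -/
theorem mem_span_fixed_rational_of_fixed {R : Type*} [Monoid R] [DistribMulAction R V]
    [SMulCommClass R k V] (S : Set R)
    (hstab : ∀ s ∈ S, ∀ i j, b.repr (s • b i) j ∈ Set.range (algebraMap M k))
    {y : V} (hy : ∀ s ∈ S, s • y = y) :
    y ∈ Submodule.span k {y₀ : V | (∀ i, b.repr y₀ i ∈ Set.range (algebraMap M k)) ∧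
      ∀ s ∈ S, s • y₀ = y₀} := by
  classical
  let c := Module.Basis.ofVectorSpace M k
  rw [← sum_smul_proj_eq b c y (T := (b.repr y).support.biUnion
    fun i => (c.repr (b.repr y i)).support) ?_]
  · refine Submodule.sum_mem _ fun β _ => Submodule.smul_mem _ _ (Submodule.subset_span ⟨?_, ?_⟩)
    · intro i
      exact ⟨_, (repr_proj b c β y i).symm⟩
    · intro s hs
      rw [smul_proj_eq_proj_smul b c s (hstab s hs), hy s hs]
  · intro i
    by_cases hi : i ∈ (b.repr y).support
    · exact Finset.subset_biUnion_of_mem (fun i => (c.repr (b.repr y i)).support) hi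
    · rw [Finsupp.notMem_support_iff] at hi
      rw [hi, map_zero, Finsupp.support_zero]
      exact Finset.empty_subset _

/-- **STEP 3 input produced from the rational form**: if (`h418_1`) below some level `K₀` every
`S K`-fixed `M`-RATIONAL vector lies in `span k (Gen K)` — [Liu2021] Thm. 4.18 (1), l. 2239,
"`Ω(μ)^K ≃ Hom_E(A_K,A_μ)_ℚ` for every sufficiently small open compact subgroup `K`", with
Rem. 4.17: the `K`-invariants of the `M_μ`-form `Ω(μ)` are (`ℚ`-, hence `k`-)combinations of
honest homomorphisms `f`, the generators being the `f ⊗ 1` — and (`hstab`) the operators have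
`M`-rational matrices (Def. 4.16), then below `K₀` EVERY `S K`-fixed vector lies in
`span k (Gen K)` (the hypothesis `hgen` of `mapReading_of_source_invariants`).
[cite: Liu2021, Thm. 4.18 (1) (l. 2239); Rem. 4.17 (ll. 2226–2228); Def. 4.16 (l. 2219)] -/
theorem span_gen_of_fixed_of_rationalForm {R : Type*} [Monoid R] [DistribMulAction R V]
    [SMulCommClass R k V] {Lvl : Type*} [Preorder Lvl] (S : Lvl → Set R)
    (hstab : ∀ K, ∀ s ∈ S K, ∀ i j, b.repr (s • b i) j ∈ Set.range (algebraMap M k))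
    (Gen : Lvl → Set V)
    (h418_1 : ∃ K₀, ∀ K ≤ K₀, ∀ y₀ : V, (∀ i, b.repr y₀ i ∈ Set.range (algebraMap M k)) →
      (∀ s ∈ S K, s • y₀ = y₀) → y₀ ∈ Submodule.span k (Gen K)) :
    ∃ K₀, ∀ K ≤ K₀, ∀ y : V, (∀ s ∈ S K, s • y = y) → y ∈ Submodule.span k (Gen K) := by
  obtain ⟨K₀, hK₀⟩ := h418_1
  refine ⟨K₀, fun K hK y hy => ?_⟩
  exact (Submodule.span_le.mpr fun y₀ hy₀ => hK₀ K hK y₀ hy₀.1 hy₀.2)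
    (mem_span_fixed_rational_of_fixed b (S K) (hstab K) hy)

end BaseChange

/-! ### Steps 3–5: the linearity step -/

section StepsThreeToFive

variable {k : Type*} [Field k] {D : Type*} [AddCommGroup D] [Module k D]
  {W : Type*} [AddCommGroup W] [Module k W]

/-- **Linearity step of Steps 3–5.**  If a `k`-linear map `f` (at the model: `res K ∘ j`,
restriction to the identity component of the pull-back) sends every geometric generator
`g ∈ Gen` into `span T` (Steps 4–5: each `(f_i^* α)|_{P_K}` is a CM class), then it sends every
`y ∈ span Gen` (Step 3: a `K`-fixed element is `Σ z_i (f_i ⊗ 1)`) into `span T`. [folklore] -/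
private theorem apply_mem_span_of_mem_span (f : D →ₗ[k] W) {Gen : Set D} {T : Set W}
    (hGen : ∀ g ∈ Gen, f g ∈ Submodule.span k T) {y : D} (hy : y ∈ Submodule.span k Gen) :
    f y ∈ Submodule.span k T :=
  (Submodule.span_le.mpr (fun g hg => hGen g hg) : Submodule.span k Gen ≤
    (Submodule.span k T).comap f) hy

end StepsThreeToFive

/-! ### Glue: Step 2 + Steps 3–5 ⇒ the map reading `hmap`; with Step 1 ⇒ the consumed shape -/

section SourceInvariants

variable {k : Type*} [Field k] {R : Type*} [Ring R] [Algebra k R]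
  {H : Type*} [AddCommGroup H] [Module R H] [Module k H] [IsScalarTower k R H]
  {Lvl : Type*} [Preorder Lvl] {W : Lvl → Type*} [∀ K, AddCommGroup (W K)] [∀ K, Module k (W K)]

/-- **The map reading `hmap` of the previous file, DERIVED from source-side hypotheses.**
Data: subspaces `Fix K` of `H` contained in the common fixed space of operator sets `S K ⊆ R`
(`hFix`; at the model `Fix K = fixedBy K H`, `S K = {[g] : g ∈ K}`); an injective `R`-linear
`j : D → H` (the pull-back map (4.2) through the isomorphism of Thm. 4.18; injective and
equivariant by its proof); «geometric generators» `Gen K ⊆ D`.  Hypotheses: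
* `hgen` — [Liu2021] Thm. 4.18 (1) (l. 2239) with Rem. 4.17 and Def. 4.16 ("acts `M_μ`-linearly"),
  read on the source: below some `K₀`, every `S K`-fixed `y : D` lies in `span k (Gen K)`
  (obtainable from the rational-form transcript by `span_gen_of_fixed_of_rationalForm`);
* `hcm` — Lem. 2.4 (1) (l. 1213) + functoriality of Betti `H¹` + the model's `adm` contract:
  `res K (j g) ∈ span k (cmCl K)` for every generator `g`.
Conclusion: below the same `K₀`, every `y` with `j y ∈ Fix K` has `res K (j y) ∈ span k (cmCl K)`.
Step 2 (`smul_eq_self_of_injective`) supplies the passage from `j y ∈ Fix K` to «`y` is fixed».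
[cite: Liu2021, Thm. 4.18 (1) l. 2239 with proof ll. 2247–2270 (eq. (4.2)); Rem. 4.17 (ll. 2226–2228); Def. 4.16 (l. 2219); Lem. 2.4 (1) (l. 1213)] -/
theorem mapReading_of_source_invariants (Fix : Lvl → Submodule k H) (res : ∀ K, H →ₗ[k] W K)
    (cmCl : ∀ K, Set (W K)) (S : Lvl → Set R) (hFix : ∀ K, ∀ x ∈ Fix K, ∀ s ∈ S K, s • x = x)
    {D : Type*} [AddCommGroup D] [Module R D] [Module k D] [IsScalarTower k R D]
    (j : D →ₗ[R] H) (hj : Function.Injective j) (Gen : Lvl → Set D)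
    (hgen : ∃ K₀, ∀ K ≤ K₀, ∀ y : D, (∀ s ∈ S K, s • y = y) → y ∈ Submodule.span k (Gen K))
    (hcm : ∀ K, ∀ g ∈ Gen K, res K (j g) ∈ Submodule.span k (cmCl K)) :
    ∃ K₀, ∀ K ≤ K₀, ∀ y : D, j y ∈ Fix K → res K (j y) ∈ Submodule.span k (cmCl K) := by
  obtain ⟨K₀, hK₀⟩ := hgen
  refine ⟨K₀, fun K hK y hy => ?_⟩
  have hyfix : ∀ s ∈ S K, s • y = y :=
    forall_smul_eq_self_of_injective j hj (S K) (hFix K _ hy)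
  exact apply_mem_span_of_mem_span ((res K).comp (j.restrictScalars k)) (hcm K) (hK₀ K hK y hyfix)

/-- **[Liu2021] Thm. 4.18 combined reading from multiplicity one + Thm. 4.18 (1) read on the
source + CM pull-back of the generators, in the kernel** — the conclusion is the package's
`LiuAlbaneseModuleDatum.Thm418Combined res cmCl` with `block μ = ⨆_a oscImage ⟨μ,a⟩`,
`oscImage t = ⨆_ψ range ψ`, `Ωt ⟨μ,a⟩ = Ω μ a` unfolded (`k = ℂ`, `R = ℂ[G]`,
`Fix K = fixedBy (Kof K) H`, `S K = {[g] : g ∈ Kof K}`), exactly as in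
`combinedReading_of_rank_hom_le_one`, whose single hypothesis `hmap` (Steps 2–5 en bloc) is here
REPLACED by:
* Step 2 — a theorem (`smul_eq_self_of_injective`; needs only `hj` and equivariance);
* `hgen` — Thm. 4.18 (1) + Rem. 4.17 + Def. 4.16 read on the source `⊕_a ω(μ,a) ≅ Ω(μ) ⊗_{M_μ} ℂ`:
  below `K₀` (Liu's threshold for ONE admissible `D_μ`, which exists by Prop. 4.6 (1)), the
  `K`-fixed vectors are spanned by the geometric generators `Gen μ h K`;
* `hcm` — Lem. 2.4 (1) + functoriality + the `adm` contract: each generator restricts to a CM class.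
The other hypotheses are those of the previous file: `hmult` ([Liu2021] proof of Prop. 4.13,
l. 2145, rank `≤ 1`), `j μ h` injective equivariant (Thm. 4.18 via (4.2)), `ω(μ,a) ≠ 0` (Def. 4.11).
[cite: Liu2021, Prop. 4.13, proof l. 2145; Thm. 4.18 (main statement and (1), ll. 2232–2245) with proof ll. 2247–2270, eq. (4.2); Rem. 4.17; Def. 4.16; Lem. 2.4 (1); Def. 4.11] -/
theorem combinedReading_of_source_invariants {Char : Type*} {Adm : Char → Type*}
    [∀ μ, DecidableEq (Adm μ)] (Ω : ∀ μ : Char, Adm μ → Type*) [∀ μ a, AddCommGroup (Ω μ a)]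
    [∀ μ a, Module R (Ω μ a)] [∀ μ a, Module k (Ω μ a)] [∀ μ a, IsScalarTower k R (Ω μ a)]
    [∀ μ a, Nontrivial (Ω μ a)] (PhiMu : Char → Prop)
    (Fix : Lvl → Submodule k H) (res : ∀ K, H →ₗ[k] W K) (cmCl : ∀ K, Char → Set (W K))
    (S : Lvl → Set R) (hFix : ∀ K, ∀ x ∈ Fix K, ∀ s ∈ S K, s • x = x)
    (hmult : ∀ μ a, Module.rank k (Ω μ a →ₗ[R] H) ≤ 1)
    (j : ∀ μ, PhiMu μ → ((⨁ a, Ω μ a) →ₗ[R] H)) (hj : ∀ μ (h : PhiMu μ), Function.Injective (j μ h))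
    (Gen : ∀ μ, PhiMu μ → Lvl → Set (⨁ a, Ω μ a))
    (hgen : ∀ μ (h : PhiMu μ), ∃ K₀, ∀ K ≤ K₀, ∀ y : ⨁ a, Ω μ a,
      (∀ s ∈ S K, s • y = y) → y ∈ Submodule.span k (Gen μ h K))
    (hcm : ∀ μ (h : PhiMu μ) K, ∀ g ∈ Gen μ h K, res K (j μ h g) ∈ Submodule.span k (cmCl K μ)) :
    ∀ μ, PhiMu μ → ∃ K₀ : Lvl, ∀ K ≤ K₀,
      ∀ x ∈ (⨆ a, ⨆ ψ : Ω μ a →ₗ[R] H, (LinearMap.range ψ).restrictScalars k),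
        x ∈ Fix K → res K x ∈ Submodule.span k (cmCl K μ) :=
  combinedReading_of_rank_hom_le_one Ω PhiMu Fix res cmCl hmult j hj fun μ h =>
    mapReading_of_source_invariants Fix res (fun K => cmCl K μ) S hFix (j μ h) (hj μ h) (Gen μ h)
      (hgen μ h) (hcm μ h)

/-- **[Liu2021] Thm. 4.18 combined reading with BOTH halves of Step 2 in the kernel** — as
`combinedReading_of_source_invariants`, but `hgen` is replaced by the data of an
`M_μ`-RATIONAL FORM of the source and the transcript of Thm. 4.18 (1) on that form:
* `b μ h` — a `k`-basis of `⊕_a ω(μ,a)`: an `M_μ`-basis of `Ω(μ)` (Def. 4.16) transported through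
  the `ℂ[G]`-linear isomorphism `Ω(μ) ⊗_{M_μ} ℂ ≃ ⊕_{ε,χ} ω(μ,ε,χ)` of Thm. 4.18 (ll. 2233–2237);
* `hstab` — the operators `[g]` have `M_μ`-rational matrices in `b μ h`: "`G(𝔸_F^∞)` acts
  `M_μ`-linearly via its action on `A_∞`" (Def. 4.16, l. 2219);
* `h418_1` (so named to keep it apart from the package's binder `h418` = conjunct (5) `Thm418C`, the CONSEQUENCE) — Thm. 4.18 (1) (l. 2239) with Rem. 4.17: below `K₀(μ, D_μ)`, every `K`-fixed
  `M_μ`-rational vector (= element of `Ω(μ)^K ⊗ 1 = Hom_E(A_K,A_μ)_ℚ ⊗ 1`) is in the span of the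
  geometric generators `Gen μ h K` (the `f ⊗ 1`, `f` an honest homomorphism `A_K → A_μ`);
* `hcm` — as before (Lem. 2.4 (1) + functoriality + `adm` contract).
The second half of Step 2 (`(Ω(μ) ⊗ ℂ)^K = Ω(μ)^K ⊗ ℂ`) is supplied by
`mem_span_fixed_rational_of_fixed`.
[cite: Liu2021, Prop. 4.13, proof l. 2145; Def. 4.16 (l. 2219); Rem. 4.17; Thm. 4.18 (main statement and (1), ll. 2232–2245) with proof ll. 2247–2270, eq. (4.2); Lem. 2.4 (1); Def. 4.11] -/
theorem combinedReading_of_rationalForm {Char : Type*} {Adm : Char → Type*}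
    [∀ μ, DecidableEq (Adm μ)] (Ω : ∀ μ : Char, Adm μ → Type*) [∀ μ a, AddCommGroup (Ω μ a)]
    [∀ μ a, Module R (Ω μ a)] [∀ μ a, Module k (Ω μ a)] [∀ μ a, IsScalarTower k R (Ω μ a)]
    [∀ μ a, Nontrivial (Ω μ a)] (PhiMu : Char → Prop)
    (Fix : Lvl → Submodule k H) (res : ∀ K, H →ₗ[k] W K) (cmCl : ∀ K, Char → Set (W K))
    (S : Lvl → Set R) (hFix : ∀ K, ∀ x ∈ Fix K, ∀ s ∈ S K, s • x = x)
    (hmult : ∀ μ a, Module.rank k (Ω μ a →ₗ[R] H) ≤ 1)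
    (j : ∀ μ, PhiMu μ → ((⨁ a, Ω μ a) →ₗ[R] H)) (hj : ∀ μ (h : PhiMu μ), Function.Injective (j μ h))
    (Mμ : Char → Type*) [∀ μ, Field (Mμ μ)] [∀ μ, Algebra (Mμ μ) k]
    {ιμ : ∀ μ, PhiMu μ → Type*} (b : ∀ μ (h : PhiMu μ), Module.Basis (ιμ μ h) k (⨁ a, Ω μ a))
    (hstab : ∀ μ (h : PhiMu μ) K, ∀ s ∈ S K, ∀ i i',
      (b μ h).repr (s • b μ h i) i' ∈ Set.range (algebraMap (Mμ μ) k))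
    (Gen : ∀ μ, PhiMu μ → Lvl → Set (⨁ a, Ω μ a))
    (h418_1 : ∀ μ (h : PhiMu μ), ∃ K₀, ∀ K ≤ K₀, ∀ y₀ : ⨁ a, Ω μ a,
      (∀ i, (b μ h).repr y₀ i ∈ Set.range (algebraMap (Mμ μ) k)) →
        (∀ s ∈ S K, s • y₀ = y₀) → y₀ ∈ Submodule.span k (Gen μ h K))
    (hcm : ∀ μ (h : PhiMu μ) K, ∀ g ∈ Gen μ h K, res K (j μ h g) ∈ Submodule.span k (cmCl K μ)) :
    ∀ μ, PhiMu μ → ∃ K₀ : Lvl, ∀ K ≤ K₀,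
      ∀ x ∈ (⨆ a, ⨆ ψ : Ω μ a →ₗ[R] H, (LinearMap.range ψ).restrictScalars k),
        x ∈ Fix K → res K x ∈ Submodule.span k (cmCl K μ) :=
  combinedReading_of_source_invariants Ω PhiMu Fix res cmCl S hFix hmult j hj Gen
    (fun μ h => span_gen_of_fixed_of_rationalForm (b μ h) S (hstab μ h) (Gen μ h) (h418_1 μ h)) hcm

/-- **The decomposition-route twin** (five-record binder: Prop. 4.13's decomposition `e`,
simplicity, pairwise non-isomorphy `hsep` instead of the rank bound), with `hmap` replaced by
Step 2 + `hgen` + `hcm` exactly as in `combinedReading_of_source_invariants`.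
[cite: Liu2021, Prop. 4.13; Def. 4.11; Thm. 4.18 (main statement, (1), (2)) with proof ll. 2247–2270, eq. (4.2); Rem. 4.17; Def. 4.16; Lem. 2.4 (1); App. D Lem. D.1 (3)] -/
theorem combinedReading_of_decomposition_of_source_invariants {Char : Type*}
    {Adm : Char → Type*} [DecidableEq Char] [∀ μ, DecidableEq (Adm μ)]
    (Ω : ∀ μ : Char, Adm μ → Type*) [∀ μ a, AddCommGroup (Ω μ a)] [∀ μ a, Module R (Ω μ a)]
    [∀ μ a, Module k (Ω μ a)] [∀ μ a, IsScalarTower k R (Ω μ a)]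
    [∀ μ a, IsSimpleModule R (Ω μ a)] (PhiMu : Char → Prop)
    (Fix : Lvl → Submodule k H) (res : ∀ K, H →ₗ[k] W K) (cmCl : ∀ K, Char → Set (W K))
    (S : Lvl → Set R) (hFix : ∀ K, ∀ x ∈ Fix K, ∀ s ∈ S K, s • x = x)
    (e : H ≃ₗ[R] ⨁ t : (Σ μ, Adm μ), Ω t.1 t.2)
    (hsep : ∀ t t' : (Σ μ, Adm μ), Nonempty (Ω t.1 t.2 ≃ₗ[R] Ω t'.1 t'.2) → t = t')
    (j : ∀ μ, PhiMu μ → ((⨁ a, Ω μ a) →ₗ[R] H)) (hj : ∀ μ (h : PhiMu μ), Function.Injective (j μ h))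
    (Gen : ∀ μ, PhiMu μ → Lvl → Set (⨁ a, Ω μ a))
    (hgen : ∀ μ (h : PhiMu μ), ∃ K₀, ∀ K ≤ K₀, ∀ y : ⨁ a, Ω μ a,
      (∀ s ∈ S K, s • y = y) → y ∈ Submodule.span k (Gen μ h K))
    (hcm : ∀ μ (h : PhiMu μ) K, ∀ g ∈ Gen μ h K, res K (j μ h g) ∈ Submodule.span k (cmCl K μ)) :
    ∀ μ, PhiMu μ → ∃ K₀ : Lvl, ∀ K ≤ K₀,
      ∀ x ∈ (⨆ a, ⨆ ψ : Ω μ a →ₗ[R] H, (LinearMap.range ψ).restrictScalars k),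
        x ∈ Fix K → res K x ∈ Submodule.span k (cmCl K μ) :=
  combinedReading_of_decomposition Ω PhiMu Fix res cmCl e hsep j hj fun μ h =>
    mapReading_of_source_invariants Fix res (fun K => cmCl K μ) S hFix (j μ h) (hj μ h) (Gen μ h)
      (hgen μ h) (hcm μ h)

end SourceInvariants

/-! ### The specialisation at the model's rings: `k = ℂ`, `R = ℂ[G]`, operators `[g]`, `g ∈ K` -/

section GroupAlgebra

variable {G : Type*} [Group G] {H : Type*} [AddCommGroup H] [Module (MonoidAlgebra ℂ G) H]
  {D : Type*} [AddCommGroup D] [Module (MonoidAlgebra ℂ G) D]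

/-- **Step 2 (first half) at `ℂ[G]`**: for an injective `ℂ[G]`-linear `j : D → H` and a subgroup
`K ≤ G` (at the model an open compact subgroup of `G = U(𝕍)(𝔸_F^∞)`), if `j y` is fixed by every
`[g]`, `g ∈ K`, then so is `y` — the package's `j y ∈ fixedBy K H → y ∈ fixedBy K D`.
[cite: Liu2021, Thm. 4.18, proof ll. 2247–2270, eq. (4.2)] -/
theorem groupAlgebra_fixed_of_fixed_apply (j : D →ₗ[MonoidAlgebra ℂ G] H)
    (hj : Function.Injective j) (K : Subgroup G) {y : D}
    (h : ∀ g ∈ K, MonoidAlgebra.of ℂ G g • j y = j y) :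
    ∀ g ∈ K, MonoidAlgebra.of ℂ G g • y = y := fun g hg =>
  smul_eq_self_of_injective j hj (h g hg)

/-- **Step 2 (second half) at `ℂ[G]`**: with a `ℂ`-basis `b` of `D` in which the operators `[g]`,
`g ∈ K`, have matrices with entries in a subfield `M` (an `M`-algebra structure on `ℂ`; at the
model `M = M_μ`, `D = Ω(μ) ⊗_{M_μ} ℂ`, Def. 4.16), every `K`-fixed vector of `D` is a
`ℂ`-combination of `K`-fixed `M`-rational vectors — `D^K = (D_M)^K ⊗_M ℂ`.
[cite: Liu2021, Def. 4.16 (l. 2219); Thm. 4.18 main statement (ll. 2233–2237)] -/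
theorem groupAlgebra_mem_span_fixed_rational [Module ℂ D] [IsScalarTower ℂ (MonoidAlgebra ℂ G) D]
    {M : Type*} [Field M] [Algebra M ℂ] {ι : Type*} (b : Module.Basis ι ℂ D) (K : Subgroup G)
    (hstab : ∀ g ∈ K, ∀ i i', b.repr (MonoidAlgebra.of ℂ G g • b i) i' ∈ Set.range (algebraMap M ℂ))
    {y : D} (hy : ∀ g ∈ K, MonoidAlgebra.of ℂ G g • y = y) :
    y ∈ Submodule.span ℂ {y₀ : D | (∀ i, b.repr y₀ i ∈ Set.range (algebraMap M ℂ)) ∧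
      ∀ g ∈ K, MonoidAlgebra.of ℂ G g • y₀ = y₀} := by
  have h := mem_span_fixed_rational_of_fixed b (MonoidAlgebra.of ℂ G '' (K : Set G))
    (by rintro _ ⟨g, hg, rfl⟩; exact hstab g hg) (y := y) (by rintro _ ⟨g, hg, rfl⟩; exact hy g hg)
  refine Submodule.span_mono (fun y₀ hy₀ => ?_) h
  exact ⟨hy₀.1, fun g hg => hy₀.2 _ ⟨g, hg, rfl⟩⟩

end GroupAlgebra

end Literature.RepresentationTheory.Liu2021
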